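import Mathlib
import Summits.AnomalousDissipation.AnomalousDissipation.Theses.PointSink
import Literature.Analysis.FunctionSpaces.TorusCalculusProofs
import Literature.Barriers.AnomalousDissipation.ClassicalEulerLimitProofs

/-!
# `PointSink.SolitonTransplant` (stmt-AnomalousDissipation-19035): estimates for the
`L^q`-no-go of the target `PointSinkZerothLaw` (support file for `PointSinkLqNoGo.lean`)

Three estimates for the terms of the weighted steady energy identity
(`PointSinkLocalEnergy.steady_weighted_energy_identity`) localised by a cut-off `χ` at scale `r`
around the sink `x₀` of the flat torus `T³`:

* `volume_ball_le_cube` — `|B_ρ(x₀)| ≤ 8ρ³` for the sup-metric balls of `T³`;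
* `flux_abs_le_of_LqBound` — the energy flux `|∫(½‖u‖²+p)Dχ[u]|` is
  `≤ (3/2) C^{3/q} r⁻¹ (216r³)^{1−3/q}` when `∫‖u‖^q, ∫|p|^{q/2} ≤ C` (`q > 3`; Hölder on the ball —
  the exponent `2 − 9/q` of `r` is positive exactly for `q > 9/2`, the Onsager/Galdi-critical
  integrability);
* `viscousTransport_abs_le` — `|ν∫∑∂ᵢχ⟪u,∂ᵢu⟫| ≤ ν^{3/2}‖∇u‖²/2 + (3/2)ν^{1/2}r⁻²‖u‖₂²` (Young);
* `workDefect_abs_le` — `|∫⟪(1−χ)f,u⟫| ≤ ‖f‖_∞ √(216r³) ‖u‖₂` (Cauchy–Schwarz).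
[folklore]
-/

set_option linter.dupNamespace false  -- `Summit.AnomalousDissipation.AnomalousDissipation` is the mandated summit/problem namespace

noncomputable section

open MeasureTheory Metric Filter Topology Set
open scoped InnerProductSpace
open Literature.Analysis.FunctionSpaces Literature.Analysis.FunctionSpaces.Torus

namespace Summit.AnomalousDissipation.AnomalousDissipation.Theorems.SolitonTransplant.Negative

/-- Cubic volume bound for sup-metric balls of the flat torus `T³`:
`volume (B_ρ(x₀)) ≤ 8ρ³` (a product of three arcs of length `≤ 2ρ`). [folklore] -/
theorem volume_ball_le_cube (x₀ : UnitAddTorus (Fin 3)) {ρ : ℝ} (hρ : 0 < ρ) :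
    volume (ball x₀ ρ) ≤ ENNReal.ofReal (8 * ρ ^ 3) := by
  have h1 : ∀ i, volume (ball (x₀ i) ρ) ≤ ENNReal.ofReal (2 * ρ) := fun i => by
    calc volume (ball (x₀ i) ρ) ≤ volume (closedBall (x₀ i) ρ) :=
          measure_mono ball_subset_closedBall
      _ = ENNReal.ofReal (min 1 (2 * ρ)) := AddCircle.volume_closedBall 1 ρ
      _ ≤ ENNReal.ofReal (2 * ρ) := ENNReal.ofReal_le_ofReal (min_le_right _ _)
  calc volume (ball x₀ ρ) = ∏ i, volume (ball (x₀ i) ρ) := volume_pi_ball x₀ hρ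
    _ ≤ ∏ _i : Fin 3, ENNReal.ofReal (2 * ρ) := Finset.prod_le_prod' fun i _ => h1 i
    _ = ENNReal.ofReal ((2 * ρ) ^ 3) := by
        rw [Finset.prod_const, Finset.card_univ, Fintype.card_fin, ENNReal.ofReal_pow (by positivity)]
    _ = ENNReal.ofReal (8 * ρ ^ 3) := by ring_nf

/-- **Flux estimate under `L^q` bounds.** For continuous (here: smooth) `u`, `p` on `T³` with
`∫‖u‖^q ≤ C`, `∫|p|^{q/2} ≤ C` (`q > 3`) and a cut-off `χ` with `‖Dχ‖ ≤ r⁻¹`, `Dχ = 0` off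
`B_{3r}(x₀)`: `|∫(½‖u‖² + p)Dχ[u]| ≤ (3/2) C^{3/q} r⁻¹ (216 r³)^{1−3/q}` (Hölder on the ball with
exponents `q/3` and its conjugate; `|B_{3r}| ≤ 216 r³`). [folklore] -/
theorem flux_abs_le_of_LqBound
    {u : UnitAddTorus (Fin 3) → EuclideanSpace ℝ (Fin 3)} {p χ : UnitAddTorus (Fin 3) → ℝ}
    (hu : IsSmooth u) (hp : IsSmooth p) (x₀ : UnitAddTorus (Fin 3)) {r : ℝ} (hr : 0 < r)
    (hχD : ∀ x, ‖Torus.fderiv χ x‖ ≤ r⁻¹) (hχD0 : ∀ x, 3 * r ≤ dist x x₀ → Torus.fderiv χ x = 0)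
    {q : ℝ} (hq : 3 < q) {C : ℝ} (hC0 : 0 ≤ C)
    (hCu : ∫ x, ‖u x‖ ^ q ≤ C) (hCp : ∫ x, |p x| ^ (q / 2) ≤ C) :
    |∫ x, (2⁻¹ * ‖u x‖ ^ 2 + p x) * Torus.fderiv χ x (u x)| ≤
      (3 / 2 * C ^ (3 / q)) * (r⁻¹ * (216 * r ^ 3) ^ (1 - 3 / q)) := by
  have hq0 : 0 < q := by linarith
  -- Hölder exponents: `a = q/3` and its conjugate `a'`; `θ = 1/a' = 1 - 3/q`
  set a : ℝ := q / 3 with ha_def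
  have ha1 : 1 < a := by rw [ha_def]; linarith
  have ha0 : 0 < a := by linarith
  have haa : a.HolderConjugate a.conjExponent := Real.HolderConjugate.conjExponent ha1
  set a' : ℝ := a.conjExponent with ha'_def
  obtain ⟨-, hinv⟩ := Real.holderConjugate_iff.mp haa
  have ha'1 : 1 < a' := (Real.holderConjugate_iff.mp haa.symm).1
  have ha'0 : 0 < a' := by linarith
  set θ : ℝ := a'⁻¹ with hθ_def
  have hθ : θ = 1 - 3 / q := by
    have : a⁻¹ = 3 / q := by rw [ha_def, inv_div]
    rw [hθ_def, ← this]; linarith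
  have hθ0 : 0 < θ := by rw [hθ_def]; positivity
  have h1a : 1 / a = 3 / q := by rw [ha_def, one_div, inv_div]
  have h32 : (3 / 2 : ℝ).HolderConjugate 3 := by
    rw [Real.holderConjugate_iff]; norm_num
  rw [← hθ]
  -- the ball `B = B_{3r}(x₀)` and its volume `V ≤ 216 r³`
  set B : Set (UnitAddTorus (Fin 3)) := ball x₀ (3 * r) with hB_def
  have hBm : MeasurableSet B := measurableSet_ball
  set V : ℝ := volume.real B with hV_def
  have hV0 : 0 ≤ V := measureReal_nonneg
  have hV : V ≤ 216 * r ^ 3 := by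
    rw [hV_def, measureReal_def]
    refine ENNReal.toReal_le_of_le_ofReal (by positivity) ?_
    calc volume B ≤ ENNReal.ofReal (8 * (3 * r) ^ 3) := volume_ball_le_cube x₀ (by positivity)
      _ = ENNReal.ofReal (216 * r ^ 3) := by ring_nf
  have hind_int : ∫ x, B.indicator (fun _ => (1 : ℝ)) x = V := by
    rw [integral_indicator hBm, setIntegral_const, smul_eq_mul, mul_one]
  have hind01 : ∀ x, 0 ≤ B.indicator (fun _ => (1 : ℝ)) x ∧ B.indicator (fun _ => (1 : ℝ)) x ≤ 1 := by
    intro x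
    by_cases hx : x ∈ B
    · rw [Set.indicator_of_mem hx]; exact ⟨zero_le_one, le_rfl⟩
    · rw [Set.indicator_of_notMem hx]; exact ⟨le_rfl, zero_le_one⟩
  have hind_rpow : ∀ (t : ℝ), 0 < t → ∀ x, (B.indicator (fun _ => (1 : ℝ)) x) ^ t =
      B.indicator (fun _ => (1 : ℝ)) x := by
    intro t ht x
    by_cases hx : x ∈ B
    · rw [Set.indicator_of_mem hx, Real.one_rpow]
    · rw [Set.indicator_of_notMem hx, Real.zero_rpow ht.ne']
  have hind_memLp : ∀ t : ENNReal, MemLp (B.indicator fun _ => (1 : ℝ)) t volume := fun t =>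
    (memLp_const (1 : ℝ)).indicator hBm
  have huc : Continuous u := hu.continuous
  have hpc : Continuous p := hp.continuous
  -- Hölder 1: `∫ ‖u‖³ 1_B ≤ (∫‖u‖^q)^{3/q} V^θ`
  have H1 : ∫ x, ‖u x‖ ^ 3 * B.indicator (fun _ => (1 : ℝ)) x ≤ C ^ (3 / q) * V ^ θ := by
    have hmem : MemLp (fun x => ‖u x‖ ^ 3) (ENNReal.ofReal a) volume :=
      (huc.norm.pow 3).memLp_of_hasCompactSupport (HasCompactSupport.of_compactSpace _)
    have h := integral_mul_le_Lp_mul_Lq_of_nonneg haa (ae_of_all _ fun x => by positivity)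
      (ae_of_all _ fun x => (hind01 x).1) hmem (hind_memLp _)
    have hpow : ∀ x, (‖u x‖ ^ 3) ^ a = ‖u x‖ ^ q := by
      intro x
      rw [← Real.rpow_natCast (‖u x‖) 3, ← Real.rpow_mul (norm_nonneg _), ha_def]
      norm_num
      ring_nf
    simp_rw [hpow, hind_rpow a' ha'0] at h
    rw [hind_int, h1a] at h
    rw [one_div, ← hθ_def] at h
    exact h.trans (mul_le_mul_of_nonneg_right
      (Real.rpow_le_rpow (integral_nonneg fun x => Real.rpow_nonneg (norm_nonneg _) _) hCu
        (by positivity)) (Real.rpow_nonneg hV0 _))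
  -- Hölder 2+3: `∫ |p|‖u‖ 1_B ≤ C^{3/q} V^θ`
  have H3 : ∫ x, (|p x| * ‖u x‖) ^ a ≤ C := by
    have hmem1 : MemLp (fun x => |p x| ^ a) (ENNReal.ofReal (3 / 2)) volume :=
      ((continuous_abs.comp hpc).rpow_const fun x => Or.inr ha0.le).memLp_of_hasCompactSupport
        (HasCompactSupport.of_compactSpace _)
    have hmem2 : MemLp (fun x => ‖u x‖ ^ a) (ENNReal.ofReal 3) volume :=
      (huc.norm.rpow_const fun x => Or.inr ha0.le).memLp_of_hasCompactSupport
        (HasCompactSupport.of_compactSpace _)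
    have h := integral_mul_le_Lp_mul_Lq_of_nonneg h32
      (ae_of_all _ fun x => Real.rpow_nonneg (abs_nonneg _) _)
      (ae_of_all _ fun x => Real.rpow_nonneg (norm_nonneg _) _) hmem1 hmem2
    have hpow1 : ∀ x, (|p x| ^ a) ^ (3 / 2 : ℝ) = |p x| ^ (q / 2) := by
      intro x; rw [← Real.rpow_mul (abs_nonneg _), ha_def]; ring_nf
    have hpow2 : ∀ x, (‖u x‖ ^ a) ^ (3 : ℝ) = ‖u x‖ ^ q := by
      intro x; rw [← Real.rpow_mul (norm_nonneg _), ha_def]; ring_nf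
    have hmul : ∀ x, (|p x| * ‖u x‖) ^ a = |p x| ^ a * ‖u x‖ ^ a := fun x =>
      Real.mul_rpow (abs_nonneg _) (norm_nonneg _)
    simp_rw [hmul]
    simp_rw [hpow1, hpow2] at h
    refine h.trans ?_
    calc (∫ x, |p x| ^ (q / 2)) ^ (1 / (3 / 2 : ℝ)) * (∫ x, ‖u x‖ ^ q) ^ (1 / (3 : ℝ))
        ≤ C ^ (1 / (3 / 2 : ℝ)) * C ^ (1 / (3 : ℝ)) :=
          mul_le_mul
            (Real.rpow_le_rpow (integral_nonneg fun x => Real.rpow_nonneg (abs_nonneg _) _)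
              hCp (by positivity))
            (Real.rpow_le_rpow (integral_nonneg fun x => Real.rpow_nonneg (norm_nonneg _) _)
              hCu (by positivity))
            (Real.rpow_nonneg (integral_nonneg fun x => Real.rpow_nonneg (norm_nonneg _) _) _)
            (Real.rpow_nonneg hC0 _)
      _ = C := by
          rw [← Real.rpow_add' hC0 (by norm_num)]
          norm_num
  have H2 : ∫ x, (|p x| * ‖u x‖) * B.indicator (fun _ => (1 : ℝ)) x ≤ C ^ (3 / q) * V ^ θ := by
    have hmem : MemLp (fun x => |p x| * ‖u x‖) (ENNReal.ofReal a) volume :=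
      ((continuous_abs.comp hpc).mul huc.norm).memLp_of_hasCompactSupport
        (HasCompactSupport.of_compactSpace _)
    have h := integral_mul_le_Lp_mul_Lq_of_nonneg haa (ae_of_all _ fun x => by positivity)
      (ae_of_all _ fun x => (hind01 x).1) hmem (hind_memLp _)
    simp_rw [hind_rpow a' ha'0] at h
    rw [hind_int, h1a] at h
    rw [one_div, ← hθ_def] at h
    exact h.trans (mul_le_mul_of_nonneg_right
      (Real.rpow_le_rpow (integral_nonneg fun x => Real.rpow_nonneg (by positivity) _) H3
        (by positivity)) (Real.rpow_nonneg hV0 _))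
  -- pointwise bound of the flux integrand
  have hbound : ∀ x, ‖(2⁻¹ * ‖u x‖ ^ 2 + p x) * Torus.fderiv χ x (u x)‖ ≤
      r⁻¹ * (2⁻¹ * (‖u x‖ ^ 3 * B.indicator (fun _ => (1 : ℝ)) x) +
        (|p x| * ‖u x‖) * B.indicator (fun _ => (1 : ℝ)) x) := by
    intro x
    by_cases hx : 3 * r ≤ dist x x₀
    · rw [hχD0 x hx]
      simp only [mul_zero, norm_zero, zero_apply]
      have h0 := (hind01 x).1
      exact mul_nonneg (inv_nonneg.mpr hr.le) (add_nonneg (mul_nonneg (by norm_num)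
        (mul_nonneg (by positivity) h0)) (mul_nonneg (by positivity) h0))
    · push Not at hx
      have hmem : x ∈ B := mem_ball.mpr hx
      rw [Set.indicator_of_mem hmem, mul_one, mul_one, norm_mul, Real.norm_eq_abs, Real.norm_eq_abs]
      have h1 : |2⁻¹ * ‖u x‖ ^ 2 + p x| ≤ 2⁻¹ * ‖u x‖ ^ 2 + |p x| := by
        calc |2⁻¹ * ‖u x‖ ^ 2 + p x| ≤ |2⁻¹ * ‖u x‖ ^ 2| + |p x| := abs_add_le _ _
          _ = 2⁻¹ * ‖u x‖ ^ 2 + |p x| := by rw [abs_of_nonneg (by positivity)]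
      have h2 : |Torus.fderiv χ x (u x)| ≤ r⁻¹ * ‖u x‖ := by
        calc |Torus.fderiv χ x (u x)| = ‖Torus.fderiv χ x (u x)‖ := (Real.norm_eq_abs _).symm
          _ ≤ ‖Torus.fderiv χ x‖ * ‖u x‖ := ContinuousLinearMap.le_opNorm _ _
          _ ≤ r⁻¹ * ‖u x‖ := mul_le_mul_of_nonneg_right (hχD x) (norm_nonneg _)
      calc |2⁻¹ * ‖u x‖ ^ 2 + p x| * |Torus.fderiv χ x (u x)|
          ≤ (2⁻¹ * ‖u x‖ ^ 2 + |p x|) * (r⁻¹ * ‖u x‖) :=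
            mul_le_mul h1 h2 (abs_nonneg _) (by positivity)
        _ = r⁻¹ * (2⁻¹ * ‖u x‖ ^ 3 + |p x| * ‖u x‖) := by ring
  have hI3 : Integrable (fun x => ‖u x‖ ^ 3 * B.indicator (fun _ => (1 : ℝ)) x) volume := by
    refine Integrable.mono' ((huc.norm.pow 3).integrable_unitAddTorus)
      ((huc.norm.pow 3).aestronglyMeasurable.mul
        (aestronglyMeasurable_const.indicator hBm)) (ae_of_all _ fun x => ?_)
    rw [Real.norm_eq_abs, abs_mul, abs_of_nonneg (show (0:ℝ) ≤ ‖u x‖ ^ 3 by positivity),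
      abs_of_nonneg (hind01 x).1]
    calc ‖u x‖ ^ 3 * B.indicator (fun _ => (1 : ℝ)) x ≤ ‖u x‖ ^ 3 * 1 :=
          mul_le_mul_of_nonneg_left (hind01 x).2 (by positivity)
      _ = ‖u x‖ ^ 3 := mul_one _
  have hIpu : Integrable (fun x => (|p x| * ‖u x‖) * B.indicator (fun _ => (1 : ℝ)) x) volume := by
    have hc : Continuous fun x => |p x| * ‖u x‖ := (continuous_abs.comp hpc).mul huc.norm
    refine Integrable.mono' hc.integrable_unitAddTorus
      (hc.aestronglyMeasurable.mul (aestronglyMeasurable_const.indicator hBm))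
      (ae_of_all _ fun x => ?_)
    rw [Real.norm_eq_abs, abs_mul, abs_of_nonneg (show (0:ℝ) ≤ |p x| * ‖u x‖ by positivity),
      abs_of_nonneg (hind01 x).1]
    calc |p x| * ‖u x‖ * B.indicator (fun _ => (1 : ℝ)) x ≤ |p x| * ‖u x‖ * 1 :=
          mul_le_mul_of_nonneg_left (hind01 x).2 (by positivity)
      _ = |p x| * ‖u x‖ := mul_one _
  have hint : Integrable (fun x => r⁻¹ * (2⁻¹ * (‖u x‖ ^ 3 * B.indicator (fun _ => (1 : ℝ)) x) +
      (|p x| * ‖u x‖) * B.indicator (fun _ => (1 : ℝ)) x)) volume :=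
    ((hI3.const_mul _).add hIpu).const_mul _
  have h := norm_integral_le_of_norm_le hint (ae_of_all _ hbound)
  rw [integral_const_mul, integral_add (hI3.const_mul _) hIpu, integral_const_mul,
    Real.norm_eq_abs] at h
  have hVθ : V ^ θ ≤ (216 * r ^ 3) ^ θ := Real.rpow_le_rpow hV0 hV hθ0.le
  have hCq : 0 ≤ C ^ (3 / q) := Real.rpow_nonneg hC0 _
  calc |∫ x, (2⁻¹ * ‖u x‖ ^ 2 + p x) * Torus.fderiv χ x (u x)|
      ≤ r⁻¹ * (2⁻¹ * (∫ x, ‖u x‖ ^ 3 * B.indicator (fun _ => (1 : ℝ)) x) +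
        ∫ x, (|p x| * ‖u x‖) * B.indicator (fun _ => (1 : ℝ)) x) := h
    _ ≤ r⁻¹ * (2⁻¹ * (C ^ (3 / q) * V ^ θ) + C ^ (3 / q) * V ^ θ) := by gcongr
    _ = (3 / 2 * C ^ (3 / q)) * (r⁻¹ * V ^ θ) := by ring
    _ ≤ (3 / 2 * C ^ (3 / q)) * (r⁻¹ * (216 * r ^ 3) ^ θ) := by gcongr

/-- **Viscous transport estimate.** For smooth `u`, `χ` with `‖Dχ‖ ≤ r⁻¹` and `ν > 0`:
`|ν ∫∑ᵢ∂ᵢχ⟪u, ∂ᵢu⟫| ≤ ν^{3/2}‖∇u‖₂²/2 + (3/2) ν^{1/2} r⁻² ∫‖u‖²` (pointwise Young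
`ν r⁻¹ ab ≤ (ν^{3/2}b² + ν^{1/2}r⁻²a²)/2`). [folklore] -/
theorem viscousTransport_abs_le
    {u : UnitAddTorus (Fin 3) → EuclideanSpace ℝ (Fin 3)} {χ : UnitAddTorus (Fin 3) → ℝ}
    (hu : IsSmooth u) (hχs : IsSmooth χ) {r : ℝ} (hr : 0 < r)
    (hχD : ∀ x, ‖Torus.fderiv χ x‖ ≤ r⁻¹) {ν : ℝ} (hν : 0 < ν) :
    |ν * ∫ x, ∑ i, partialDeriv i χ x * ⟪u x, partialDeriv i u x⟫_ℝ| ≤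
      Real.sqrt ν ^ 3 * gradNormSq u / 2 +
        3 * ((Real.sqrt ν / r ^ 2) * (∫ x, ‖u x‖ ^ 2) / 2) := by
  have hχ1' : IsContDiff 1 χ := hχs.isContDiff (by simp)
  have hyoung : ∀ {s a c : ℝ}, 0 ≤ s → s ^ 2 * c * a ≤ (s ^ 3 * a ^ 2 + s * c ^ 2) / 2 := by
    intro s a c hs
    nlinarith [mul_nonneg hs (sq_nonneg (s * a - c))]
  set s : ℝ := Real.sqrt (ν) with hs_def
  have hs0 : 0 ≤ s := Real.sqrt_nonneg _
  have hs2 : s ^ 2 = ν := Real.sq_sqrt hν.le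
  have hdχ : ∀ i x, |partialDeriv i χ x| ≤ r⁻¹ := by
    intro i x
    rw [partialDeriv_eq_fderiv_apply hχ1']
    calc |Torus.fderiv χ x (EuclideanSpace.single i 1)|
        = ‖Torus.fderiv χ x (EuclideanSpace.single i 1)‖ := (Real.norm_eq_abs _).symm
      _ ≤ ‖Torus.fderiv χ x‖ * ‖EuclideanSpace.single i (1 : ℝ)‖ := ContinuousLinearMap.le_opNorm _ _
      _ ≤ r⁻¹ * 1 := by
          gcongr
          · exact hχD x
          · rw [PiLp.norm_single, norm_one]
      _ = r⁻¹ := mul_one _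
  have hpt : ∀ x, ‖ν * ∑ i, partialDeriv i χ x * ⟪u x, partialDeriv i u x⟫_ℝ‖ ≤
      ∑ i, (s ^ 3 * ‖partialDeriv i u x‖ ^ 2 + s * (‖u x‖ / r) ^ 2) / 2 := by
    intro x
    rw [Real.norm_eq_abs, abs_mul, abs_of_pos hν]
    calc ν * |∑ i, partialDeriv i χ x * ⟪u x, partialDeriv i u x⟫_ℝ|
        ≤ ν * ∑ i, |partialDeriv i χ x * ⟪u x, partialDeriv i u x⟫_ℝ| := by
          gcongr
          exact Finset.abs_sum_le_sum_abs _ _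
      _ = ∑ i, ν * |partialDeriv i χ x * ⟪u x, partialDeriv i u x⟫_ℝ| :=
          Finset.mul_sum _ _ _
      _ ≤ _ := Finset.sum_le_sum fun i _ => ?_
    rw [abs_mul]
    have ha : 0 ≤ ‖partialDeriv i u x‖ := norm_nonneg _
    have h1 : |⟪u x, partialDeriv i u x⟫_ℝ| ≤ ‖u x‖ * ‖partialDeriv i u x‖ :=
      abs_real_inner_le_norm _ _
    calc ν * (|partialDeriv i χ x| * |⟪u x, partialDeriv i u x⟫_ℝ|)
        ≤ ν * (r⁻¹ * (‖u x‖ * ‖partialDeriv i u x‖)) := by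
          gcongr
          exact hdχ i x
      _ = s ^ 2 * (‖u x‖ / r) * ‖partialDeriv i u x‖ := by rw [hs2]; ring
      _ ≤ (s ^ 3 * ‖partialDeriv i u x‖ ^ 2 + s * (‖u x‖ / r) ^ 2) / 2 := hyoung hs0
  have hGi : ∀ i, Integrable (fun x => ‖partialDeriv i u x‖ ^ 2) volume := fun i =>
    (hu.partialDeriv i).norm_sq.integrable
  have hU2 : Integrable (fun x => ‖u x‖ ^ 2) volume := hu.norm_sq.integrable
  have hIi : ∀ i, Integrable (fun x => (s ^ 3 * ‖partialDeriv i u x‖ ^ 2 +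
      s * (‖u x‖ / r) ^ 2) / 2) volume := by
    intro i
    have h2 : Integrable (fun x => s * (‖u x‖ / r) ^ 2) volume := by
      have : (fun x => s * (‖u x‖ / r) ^ 2) = fun x => (s / r ^ 2) * ‖u x‖ ^ 2 := by
        funext x; field_simp
      rw [this]; exact hU2.const_mul _
    exact (((hGi i).const_mul _).add h2).div_const _
  have hint : Integrable (fun x => ∑ i, (s ^ 3 * ‖partialDeriv i u x‖ ^ 2 +
      s * (‖u x‖ / r) ^ 2) / 2) volume := integrable_finsetSum _ fun i _ => hIi i
  have h := norm_integral_le_of_norm_le hint (ae_of_all _ hpt)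
  rw [integral_const_mul, Real.norm_eq_abs] at h
  refine h.trans ?_
  rw [integral_finsetSum _ fun i _ => hIi i]
  have hterm : ∀ i, ∫ x, (s ^ 3 * ‖partialDeriv i u x‖ ^ 2 + s * (‖u x‖ / r) ^ 2) / 2 =
      (s ^ 3 * ∫ x, ‖partialDeriv i u x‖ ^ 2) / 2 + (s / r ^ 2) * (∫ x, ‖u x‖ ^ 2) / 2 := by
    intro i
    have h2 : (fun x => s * (‖u x‖ / r) ^ 2) = fun x => (s / r ^ 2) * ‖u x‖ ^ 2 := by
      funext x; field_simp
    have hI2 : Integrable (fun x => s * (‖u x‖ / r) ^ 2) volume := by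
      rw [h2]; exact hU2.const_mul _
    rw [integral_div, integral_add ((hGi i).const_mul _) hI2, integral_const_mul, h2,
      integral_const_mul]
    ring
  simp_rw [hterm]
  rw [Finset.sum_add_distrib, Finset.sum_const, Finset.card_univ, Fintype.card_fin,
    ← Finset.sum_div, ← Finset.mul_sum]
  have hG : ∑ i, ∫ x, ‖partialDeriv i u x‖ ^ 2 = gradNormSq u := by
    rw [gradNormSq, integral_finsetSum _ fun i _ => hGi i]
  rw [hG]
  rw [nsmul_eq_mul]
  push_cast
  ring_nf
  rfl

/-- **Work defect estimate.** For smooth `f`, `u` and a cut-off `0 ≤ χ ≤ 1` with `χ = 1` off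
`B_{5r/2}(x₀)`, `‖f‖ ≤ Cf`: `|∫⟪(1−χ)f, u⟫| ≤ Cf √(216 r³) ‖u‖₂` (Cauchy–Schwarz and
`|B_{3r}| ≤ 216 r³`). [folklore] -/
theorem workDefect_abs_le
    {f u : UnitAddTorus (Fin 3) → EuclideanSpace ℝ (Fin 3)} {χ : UnitAddTorus (Fin 3) → ℝ}
    (hf : IsSmooth f) (hu : IsSmooth u) (hχs : IsSmooth χ) (hχ01 : ∀ x, 0 ≤ χ x ∧ χ x ≤ 1)
    (x₀ : UnitAddTorus (Fin 3)) {r : ℝ} (hr : 0 < r) (hχ1 : ∀ x, 5 * r / 2 < dist x x₀ → χ x = 1)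
    {Cf : ℝ} (hCf0 : 0 ≤ Cf) (hCf : ∀ x, ‖f x‖ ≤ Cf) :
    |∫ x, ⟪(1 - χ x) • f x, u x⟫_ℝ| ≤
      Cf * Real.sqrt (216 * r ^ 3) * Real.sqrt (∫ x, ‖u x‖ ^ 2) := by
  -- the ball `B = B_{3r}(x₀)` and its volume `V ≤ 216 r³`
  set B : Set (UnitAddTorus (Fin 3)) := ball x₀ (3 * r) with hB_def
  have hBm : MeasurableSet B := measurableSet_ball
  set V : ℝ := volume.real B with hV_def
  have hV0 : 0 ≤ V := measureReal_nonneg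
  have hV : V ≤ 216 * r ^ 3 := by
    rw [hV_def, measureReal_def]
    refine ENNReal.toReal_le_of_le_ofReal (by positivity) ?_
    calc volume B ≤ ENNReal.ofReal (8 * (3 * r) ^ 3) := volume_ball_le_cube x₀ (by positivity)
      _ = ENNReal.ofReal (216 * r ^ 3) := by ring_nf
  have hind_int : ∫ x, B.indicator (fun _ => (1 : ℝ)) x = V := by
    rw [integral_indicator hBm, setIntegral_const, smul_eq_mul, mul_one]
  have hind01 : ∀ x, 0 ≤ B.indicator (fun _ => (1 : ℝ)) x ∧ B.indicator (fun _ => (1 : ℝ)) x ≤ 1 := by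
    intro x
    by_cases hx : x ∈ B
    · rw [Set.indicator_of_mem hx]; exact ⟨zero_le_one, le_rfl⟩
    · rw [Set.indicator_of_notMem hx]; exact ⟨le_rfl, zero_le_one⟩
  have huc : Continuous u := hu.continuous
  have hg : IsSmooth (fun x => (1 - χ x) • f x) := ((isSmooth_const (1 : ℝ)).sub hχs).smul' hf
  have hcs := Literature.Barriers.AnomalousDissipation.Torus.abs_integral_inner_le_sqrt_mul_sqrt
    hg.continuous huc
  have hg2 : ∫ x, ‖(1 - χ x) • f x‖ ^ 2 ≤ Cf ^ 2 * V := by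
    have hb : ∀ x, ‖(1 - χ x) • f x‖ ^ 2 ≤ Cf ^ 2 * B.indicator (fun _ => (1 : ℝ)) x := by
      intro x
      by_cases hx : 5 * r / 2 < dist x x₀
      · rw [hχ1 x hx, sub_self, zero_smul, norm_zero, zero_pow two_ne_zero]
        exact mul_nonneg (sq_nonneg _) (hind01 x).1
      · push Not at hx
        have hmem : x ∈ B := mem_ball.mpr (by linarith)
        rw [Set.indicator_of_mem hmem, mul_one, norm_smul, mul_pow, Real.norm_eq_abs]
        have h1 : |1 - χ x| ≤ 1 := by
          rw [abs_le]; constructor <;> linarith [(hχ01 x).1, (hχ01 x).2]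
        have h1' : |1 - χ x| ^ 2 ≤ 1 := by
          calc |1 - χ x| ^ 2 ≤ 1 ^ 2 := pow_le_pow_left₀ (abs_nonneg _) h1 2
            _ = 1 := one_pow 2
        have h2 : ‖f x‖ ^ 2 ≤ Cf ^ 2 := pow_le_pow_left₀ (norm_nonneg _) (hCf x) 2
        calc |1 - χ x| ^ 2 * ‖f x‖ ^ 2 ≤ 1 * Cf ^ 2 :=
              mul_le_mul h1' h2 (by positivity) zero_le_one
          _ = Cf ^ 2 := one_mul _
    calc ∫ x, ‖(1 - χ x) • f x‖ ^ 2 ≤ ∫ x, Cf ^ 2 * B.indicator (fun _ => (1 : ℝ)) x :=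
          integral_mono (hg.continuous.norm.pow 2).integrable_unitAddTorus
            (((integrable_const (1 : ℝ)).indicator hBm).const_mul _) hb
      _ = Cf ^ 2 * V := by rw [integral_const_mul, hind_int]
  refine hcs.trans ?_
  have h1 : Real.sqrt (∫ x, ‖(1 - χ x) • f x‖ ^ 2) ≤ Cf * Real.sqrt V := by
    calc Real.sqrt (∫ x, ‖(1 - χ x) • f x‖ ^ 2) ≤ Real.sqrt (Cf ^ 2 * V) := Real.sqrt_le_sqrt hg2
      _ = Cf * Real.sqrt V := by rw [Real.sqrt_mul (sq_nonneg _), Real.sqrt_sq hCf0]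
  have h3 : Real.sqrt V ≤ Real.sqrt (216 * r ^ 3) := Real.sqrt_le_sqrt hV
  calc Real.sqrt (∫ x, ‖(1 - χ x) • f x‖ ^ 2) * Real.sqrt (∫ x, ‖u x‖ ^ 2)
      ≤ (Cf * Real.sqrt V) * Real.sqrt (∫ x, ‖u x‖ ^ 2) :=
        mul_le_mul_of_nonneg_right h1 (Real.sqrt_nonneg _)
    _ ≤ (Cf * Real.sqrt (216 * r ^ 3)) * Real.sqrt (∫ x, ‖u x‖ ^ 2) := by gcongr

end Summit.AnomalousDissipation.AnomalousDissipation.Theorems.SolitonTransplant.Negative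

end
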